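import Literature.NumberTheory.EllipticCurves.BSDInvariants
import Literature.NumberTheory.EllipticCurves.HeightsProofs
import HarnessLib

/-!
# Gross–Zagier over `ℚ`: `L'(E, 1)` is a non-zero rational multiple of `Ω · ĥ(P)`

Named literature fact (T0, statement level; D-0014) for the BSD rank `≤ 1` cell
(`run/shared/lean/brief/bsd-rank1/`): Theorem I.(7.3) of Gross–Zagier 1986 — the statement OVER
`ℚ` that the derivative `L'(E, 1)` of a (modular) elliptic curve with `L(E, 1) = 0` is a NON-ZERO
RATIONAL multiple of `Ω · ĥ(P)` for a rational point `P`, and hence that in analytic and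
Mordell–Weil rank one the Birch–Swinnerton-Dyer leading-term formula holds up to `ℚ^×`. It is the
rank-one companion of the Manin–Drinfeld rationality `L(E, 1)/Ω ∈ ℚ` and the exact input of the
cell's frame "(B) `LeadPosRat`" (`RUNGS.md` §2) on the rationality side; the tree's older
`WeierstrassCurve.gross_zagier_rank_one_rat` (`GrossZagierRankOne.lean`: `L'(E,1) = c · ĥ(P)` with
a REAL `c > 0`) records positivity but not rationality, and the formula over `K` with its exact
constant is `Literature.NumberTheory.EllipticCurves.gross_zagier` (`HeegnerPoints.lean`, Thm. V.(2.1)).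

## Source (read: corpus `paper:url-d19484107fe2`, the OCR'd full text of GZ86, pp. 230–231 and 310–312)

B. H. Gross, D. B. Zagier, *Heegner points and derivatives of `L`-series*, Invent. Math. 84
(1986), 225–320 [GrossZagier1986]. I.§7, p. 231, after (7.1) (`E/ℚ` with `L(E, s) = L(f, s)` for a
weight-2 newform `f` of level `N_E` — "we will assume it is true for all of the elliptic curves
considered below") and (7.2) (`L^{(r)}(E, 1) = c_E · Ω · R`, "where `Ω` is the real period of a
regular differential on `E` over `ℚ`, `R = det(⟨P_i, P_j⟩)` is the regulator of the global
height pairing on a basis `(P_1, …, P_r)` of `E(ℚ) ⊗ ℚ` and `c_E` is a non-zero rational number"):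

"(7.3) **Theorem.** Assume that `L(E, 1) = 0`. Then there is a rational point `P` in `E(ℚ)` such
that `L'(E, 1) = α · Ω · ⟨P, P⟩` with `α ∈ ℚ^×`. In particular: 1) If `L'(E, 1) ≠ 0`, then `E(ℚ)`
contains elements of infinite order. 2) If `L'(E, 1) ≠ 0` and `rank E(ℚ) = 1`, then formula
(7.2) is true for some non-zero rational number `c_E`."

Restated V.§2, p. 310: "The assertion of Theorem (7.3) of Chap. I was that, if `L(E, 1)`
vanishes, the quotient of `L'(E, 1)` by the real period of a regular differential of `E/ℚ` is a
non-zero rational multiple of the height of some point in `E(ℚ)`", proved there (pp. 312–313)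
from Thm. V.(2.1) (`L'(E/K, 1) = ‖ω‖² ĥ(P_K)/(c² u² |D|^{1/2})`), Waldspurger's theorem (a `K`
with `L(E^{(D)}, 1) ≠ 0`), modular symbols (`L(E', 1) = β' Ω'`, `β' ∈ ℚ`) and
`‖ω‖²/|D|^{1/2} = [E(ℝ) : E(ℝ)⁰]⁻¹ Ω Ω'`, with `P = P_K + P̄_K ∈ E(ℚ)`. Secondary statement:
J. Coates, Sém. Bourbaki exp. 635 (1984/85), Thm. 5 (corpus `paper:url-cc937888c98e`, p. 65).

## Faithfulness notes

* Modularity of `E`, assumed in the source, is a theorem (Breuil–Conrad–Diamond–Taylor 2001,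
  Thm. A; tree fact `WeierstrassCurve.hasEntireLFunction_rat`), so the fact quantifies over all
  elliptic `W/ℚ`; `L(E, s)` is the tree's `WeierstrassCurve.entireLFunction` (the entire
  continuation), `L(E, 1) = 0` is `W.entireLFunction 1 = 0` and `L'(E, 1)` is
  `deriv W.entireLFunction 1`.
* `Ω`: the tree's `WeierstrassCurve.realPeriodRat W = ∫_{E(ℝ)} |ω_W|` IS "the real period of a
  regular differential on `E` over `ℚ`" (the invariant differential of the model `W`); another
  regular differential, or the connected-component convention, changes `Ω` by a non-zero RATIONAL
  factor, absorbed by `α` — so no minimality hypothesis is needed and none is printed.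
* `⟨P, P⟩ = ĥ(P)`: the tree's `WeierstrassCurve.Affine.Point.canonicalHeight` on `E(ℚ)` (Tate's
  limit, Clay normalisation); Gross–Zagier's `ĥ` differs from it by a positive rational factor
  (a power of `2`), again absorbed by `α`. Likewise `R` is the tree's `WeierstrassCurve.regulator`
  (Gram determinant of the tree's pairing on a basis of `E(ℚ)/tors`).
* Clause 2) is vendored as the second conjunct, verbatim (`rank E(ℚ)` = `W.mordellWeilRank`;
  under `L(E,1) = 0 ≠ L'(E,1)` one has `r = 1`, so (7.2) reads `L'(E, 1) = c_E · Ω · R`). Clause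
  1) is PROVED below from the main clause (`exists_not_isOfFinAddOrder_of_deriv_ne_zero`: a point
  of non-zero canonical height has infinite order, tree theorem
  `canonicalHeight_of_isOfFinAddOrder_holds`).
* Nothing here asserts positivity of `α` (not printed in (7.3); it follows from Thm. V.(2.1) and
  `L(E^{(D)}, 1) > 0`, cf. `gross_zagier_rank_one_rat`).

## Contents

* `GrossZagier1986_thm_I_7_3` — the named fact (both printed clauses).
* `GrossZagier1986_thm_I_7_3.exists_point`, `.exists_rat_of_mordellWeilRank_eq_one` — projections.
* `exists_not_isOfFinAddOrder_of_deriv_ne_zero` — clause 1), proved.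
* `entireLFunction_one_eq_zero_of_analyticRank_eq_one`, `leadingLCoeff_eq_deriv_of_analyticRank_eq_one`
  (elementary, Mathlib's `analyticOrderAt` API) and `leadingLCoeff_eq_rat_mul_of_analyticRank_eq_one`
  — the frame-(B) shape: `ord_{s=1} L(E,s) = 1 ∧ rank E(ℚ) = 1 ⇒ L^{(r)}(E,1)/r! = c · Ω · Reg`,
  `c ∈ ℚ^×`.
-/

noncomputable section

open scoped Classical

open WeierstrassCurve

namespace Literature.NumberTheory.EllipticCurves

/-! ### The named fact -/

/-- **Gross–Zagier 1986, Thm. I.(7.3)** (Invent. Math. 84, p. 231: "Assume that `L(E, 1) = 0`.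
Then there is a rational point `P` in `E(ℚ)` such that `L'(E, 1) = α · Ω · ⟨P, P⟩` with
`α ∈ ℚ^×`. In particular: 1) If `L'(E, 1) ≠ 0`, then `E(ℚ)` contains elements of infinite order.
2) If `L'(E, 1) ≠ 0` and `rank E(ℚ) = 1`, then formula (7.2) [`L^{(r)}(E, 1) = c_E · Ω · R`] is
true for some non-zero rational number `c_E`"; `E/ℚ` modular — now every `E/ℚ`, BCDT 2001 —,
`Ω` the real period of a regular differential on `E` over `ℚ`, `⟨ , ⟩` the global height pairing
on `E(ℚ)`, `R` its regulator). In the tree's vocabulary, for every elliptic `W/ℚ` with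
`L(E, 1) = W.entireLFunction 1 = 0`: (main clause) there are `P ∈ E(ℚ)` and `α ∈ ℚ`, `α ≠ 0`,
with `L'(E, 1) = α · Ω(W) · ĥ(P)` (`deriv W.entireLFunction 1`, `W.realPeriodRat`,
`canonicalHeight`); (clause 2) if moreover `L'(E, 1) ≠ 0` and `rank_ℤ E(ℚ) = 1`
(`W.mordellWeilRank`), there is `c ∈ ℚ`, `c ≠ 0`, with `L'(E, 1) = c · Ω(W) · Reg(E/ℚ)`
(`W.regulator`). Rational rescalings of `Ω`, `ĥ`, `Reg` between the source's and the tree's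
normalisations are absorbed by `α`, `c` (module docstring). Clause 1) is the proved
`exists_not_isOfFinAddOrder_of_deriv_ne_zero`. Size L (Thm. V.(2.1) = tree fact `gross_zagier`,
Waldspurger / Bump–Friedberg–Hoffstein non-vanishing twist, Manin–Drinfeld for the twist, the
period relation `‖ω‖²/√|D| = Ω Ω'/[E(ℝ):E(ℝ)⁰]` and the height of `P_K + P̄_K`); no `_holds`.
[cite: GrossZagier1986, Thm. I.(7.3) (p. 231); proof V.§2 (pp. 310–313)] -/
def GrossZagier1986_thm_I_7_3 : Prop :=
  ∀ (W : WeierstrassCurve ℚ) [W.IsElliptic], W.entireLFunction 1 = 0 →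
    (∃ (P : W.toAffine.Point) (α : ℚ), α ≠ 0 ∧
        deriv W.entireLFunction 1 = (((α : ℝ) * W.realPeriodRat * P.canonicalHeight : ℝ) : ℂ)) ∧
    (deriv W.entireLFunction 1 ≠ 0 → W.mordellWeilRank = 1 →
      ∃ c : ℚ, c ≠ 0 ∧
        deriv W.entireLFunction 1 = (((c : ℝ) * W.realPeriodRat * W.regulator : ℝ) : ℂ))

/-! ### API -/

variable {W : WeierstrassCurve ℚ}

/-- Main clause of Gross–Zagier 1986, Thm. I.(7.3): `L(E,1) = 0 ⇒ ∃ P ∈ E(ℚ), α ∈ ℚ^×` with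
`L'(E, 1) = α Ω ĥ(P)`. [cite: GrossZagier1986, Thm. I.(7.3)] -/
theorem GrossZagier1986_thm_I_7_3.exists_point (h : GrossZagier1986_thm_I_7_3) [W.IsElliptic]
    (h0 : W.entireLFunction 1 = 0) :
    ∃ (P : W.toAffine.Point) (α : ℚ), α ≠ 0 ∧
      deriv W.entireLFunction 1 = (((α : ℝ) * W.realPeriodRat * P.canonicalHeight : ℝ) : ℂ) :=
  (h W h0).1

/-- Clause 2) of Gross–Zagier 1986, Thm. I.(7.3): `L(E,1) = 0 ≠ L'(E,1)` and `rank E(ℚ) = 1`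
give `L'(E, 1) = c Ω Reg` with `c ∈ ℚ^×` (formula (7.2) up to `ℚ^×`).
[cite: GrossZagier1986, Thm. I.(7.3) 2)] -/
theorem GrossZagier1986_thm_I_7_3.exists_rat_of_mordellWeilRank_eq_one
    (h : GrossZagier1986_thm_I_7_3) [W.IsElliptic] (h0 : W.entireLFunction 1 = 0)
    (h1 : deriv W.entireLFunction 1 ≠ 0) (hr : W.mordellWeilRank = 1) :
    ∃ c : ℚ, c ≠ 0 ∧
      deriv W.entireLFunction 1 = (((c : ℝ) * W.realPeriodRat * W.regulator : ℝ) : ℂ) :=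
  (h W h0).2 h1 hr

/-- **Clause 1) of Gross–Zagier 1986, Thm. I.(7.3), proved from the main clause**: if
`L(E, 1) = 0` and `L'(E, 1) ≠ 0` then `E(ℚ)` contains an element of infinite order — the point
`P` of the theorem has `ĥ(P) ≠ 0`, and torsion points have canonical height `0`
(`canonicalHeight_of_isOfFinAddOrder_holds`, Silverman VIII.9.3(d)).
[cite: GrossZagier1986, Thm. I.(7.3) 1)] -/
theorem exists_not_isOfFinAddOrder_of_deriv_ne_zero (h : GrossZagier1986_thm_I_7_3)
    [W.IsElliptic] (h0 : W.entireLFunction 1 = 0) (h1 : deriv W.entireLFunction 1 ≠ 0) :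
    ∃ P : W.toAffine.Point, ¬ IsOfFinAddOrder P := by
  obtain ⟨P, α, -, hP⟩ := h.exists_point h0
  refine ⟨P, fun htor => h1 ?_⟩
  -- (`convert`: the `DecidableEq ℚ` instance inside `E(ℚ)`'s group law is the computable one
  -- here and the classical one in `Heights.lean`; they agree by subsingleton elimination.)
  have hh : P.canonicalHeight = 0 :=
    Affine.Point.canonicalHeight_of_isOfFinAddOrder_holds (W := W) (by convert htor)
  rw [hP, hh, mul_zero, Complex.ofReal_zero]

/-- If `ord_{s=1} L(W, s) = 1` then `L(W, 1) = 0` (a genuine positive order forces vanishing;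
Mathlib `apply_eq_zero_of_analyticOrderNatAt_ne_zero`). [folklore] -/
theorem entireLFunction_one_eq_zero_of_analyticRank_eq_one (hr : W.analyticRank = 1) :
    W.entireLFunction 1 = 0 :=
  apply_eq_zero_of_analyticOrderNatAt_ne_zero (f := W.entireLFunction) (by
    change W.analyticRank ≠ 0
    rw [hr]; exact one_ne_zero)

/-- If `ord_{s=1} L(W, s) = 1` then the BSD leading coefficient `L^{(r)}(W,1)/r!` is `L'(W, 1)`
and it is non-zero (Taylor expansion: Mathlib `analyticOrderAt_eq_nat_iff_iteratedDeriv_eq_zero`).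
[folklore] -/
theorem leadingLCoeff_eq_deriv_of_analyticRank_eq_one (hr : W.analyticRank = 1) :
    W.leadingLCoeff = deriv W.entireLFunction 1 ∧ deriv W.entireLFunction 1 ≠ 0 := by
  have hlead : W.leadingLCoeff = deriv W.entireLFunction 1 := by
    simp [WeierstrassCurve.leadingLCoeff, hr, iteratedDeriv_one]
  refine ⟨hlead, ?_⟩
  have h0 : analyticOrderNatAt W.entireLFunction 1 ≠ 0 := by
    change W.analyticRank ≠ 0
    rw [hr]; exact one_ne_zero
  have han : AnalyticAt ℂ W.entireLFunction 1 := by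
    by_contra hna
    exact h0 (analyticOrderNatAt_of_not_analyticAt hna)
  have htop : analyticOrderAt W.entireLFunction 1 ≠ ⊤ := by
    intro ht
    exact h0 (by simp [analyticOrderNatAt, ht])
  have hord : analyticOrderAt W.entireLFunction 1 = ((1 : ℕ) : ℕ∞) := by
    rw [← Nat.cast_analyticOrderNatAt htop]
    exact congrArg _ hr
  obtain ⟨-, hne⟩ := (analyticOrderAt_eq_nat_iff_iteratedDeriv_eq_zero han).mp hord
  rwa [iteratedDeriv_one] at hne

/-- **Frame (B) in analytic rank one, from Gross–Zagier I.(7.3) 2).** If `ord_{s=1} L(E, s) = 1`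
and `rank_ℤ E(ℚ) = 1` (the latter is Kolyvagin's theorem in this situation, tree fact
`rank_eq_analyticRank_of_analyticRank_le_one`), then the BSD leading coefficient is a non-zero
rational multiple of `Ω · Reg`: `L'(E, 1) = c · Ω(W) · Reg(E/ℚ)`, `c ∈ ℚ^×`.
[cite: GrossZagier1986, Thm. I.(7.3) 2)] -/
theorem leadingLCoeff_eq_rat_mul_of_analyticRank_eq_one (h : GrossZagier1986_thm_I_7_3)
    [W.IsElliptic] (hr : W.analyticRank = 1) (hrk : W.mordellWeilRank = 1) :
    ∃ c : ℚ, c ≠ 0 ∧ W.leadingLCoeff = (((c : ℝ) * W.realPeriodRat * W.regulator : ℝ) : ℂ) := by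
  obtain ⟨hlead, hder⟩ := leadingLCoeff_eq_deriv_of_analyticRank_eq_one hr
  obtain ⟨c, hc, hcL⟩ := h.exists_rat_of_mordellWeilRank_eq_one
    (entireLFunction_one_eq_zero_of_analyticRank_eq_one hr) hder hrk
  exact ⟨c, hc, hlead.trans hcL⟩

end Literature.NumberTheory.EllipticCurves

end
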